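import Literature.NumberTheory.IwasawaTheory.CyclotomicColemanMap
import Literature.NumberTheory.IwasawaTheory.CyclotomicUnitRegulator
import HarnessLib

/-!
# The `χ`-part of the closed cyclotomic units `𝒞` is generated by the projection of the conductor-level
# Sinnott family (Tsuji 1999, Lemma 6.2 (a)); what the Coleman-map fact already gives (cyclicity of `𝒞^χ`)

Topic `Literature/NumberTheory/IwasawaTheory` (namespace = path).  Sequel of `CyclotomicColemanMap.lean` (the pinned
`Λ`-datum `CyclotomicSemilocalUnitData` of `𝓤 = lim← 𝓤_{K_n}` with `𝒞`, `𝓤^χ = chiPart`, `𝒞^χ = cycChi`, Sinnott's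
`sinnottNorm`, and the named fact `tsuji1999_thm31_colemanMap`) and of `CyclotomicUnitRegulator.lean`
(`CyclotomicUnits.IsCompatibleRootSystem`).  Cell bsd-cm, seat bsd-cm-k-ty1 g25, row (GENUS-PORT-A3) block (U1g) of the SUMMON
`wake/SUMMON-bsd-cm-k-ty1-20260830T1731Z.md` (16c4e918e43e0aee): the print behind input (4b) `SinnottSpanShape` of crux K1ᵘ
(`Summits/…/Additive/RamifiedSevenGenusUnitSide.lean`).  No `instance`, no `notation`; nothing about elliptic curves or BSD.

## The print (Tsuji 1999 = [Tsuji1999]; held text `paper:doi-10-1006-jnth-1999-2398`, journal pages)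

* §6 p. 20 L33–45: for `m′ ∣ m`, `m′ ≠ 1`, the norm-coherent Sinnott family
  `ξ_{m′} = ξ_{m′,F} := (N_{ℚ(μ_{m′p^{n+1}})/ℚ(μ_{m′p^{n+1}}) ∩ K_n}(1 − ζ_{p^{n+1}}ζ_{m′}))_{n ≥ 0} ∈ lim← C_{K_n}`, read in `𝓤` through
  the projection `(O_{K_n} ⊗ ℤ_p)^× → 𝓤_{K_n}` («Since `(O_{K_n} ⊗ ℤ_p)^×` is decomposed into a product of `𝓤_{K_n}` and a finite
  group of order prime to `p`, there is the projection … We shall also denote by `ξ_{m′}` its image under the projection»).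
* p. 20 L58–60, **Lemma 6.1** «[5, Lemma 2.3]. The `ℤ_p[G]⟦Γ⟧`-module `𝒞` is generated by `{ζ = (ζ_{p^n}), ξ_{m′} | m′ ∣ m}`»
  ([5] = C. Greither, Ann. Inst. Fourier 42 (1992), Lemma 2.3).
* p. 20 L62–65: «For `ξ ∈ 𝓤`, we denote by `ξ^{e_χ}` or `ξ^χ` its image under the canonical surjection `𝓤 → 𝓤^χ`.  Let `C^χ`
  denote the image of `C` under `𝓤 → 𝓤^χ`.  Then we have an isomorphism `(𝓤/C)^χ ≅ 𝓤^χ/C^χ`.»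
* p. 21 L5–8, **Lemma 6.2.** «Assume `χ = ψω^i` is a non-trivial, even character of `G`.  The following assertions hold:
  (a) The `Λ_χ`-module `C^χ` is generated by `ξ_f^{e_χ ω_ψ}`, where `ω_ψ = Σ_δ ψ(δ)⁻¹δ`, `δ` running over all elements in
  `Gal(ℚ(μ_f) ∩ F/ℚ)`.  (b) The `Λ_χ`-module `C_χ` is generated by `{ξ_{m′,χ} | …}`.»  PROOF of (a) (p. 21 L10–24): `C^χ ⊇ (ξ_f^{e_χω_ψ})`
  clearly; `C^χ/(ξ_f^{e_χω_ψ})` is annihilated by `#Δ`; for `ξ′ ∈ C^χ`, `ξ′^{p^t} = ξ_f^{e_χω_ψ}·h(T)`; «Using Lemma 5.1 (a), one can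
  show that `Col(ξ_f^{e_χω_ψ}) = ω_ψ(e_χ Col(ξ_f)) = −v(T)g_χ(T)ω_ψ(Tr(ζ_f))e_χ`, as in the proof of Theorem 4.3 … By the
  Ferrero–Washington theorem [3], `g_χ(T)` is prime to `p` … Thus we have `p^t ∣ h(T)` … since `χ` is even.  It follows that
  `C^χ ⊆ (ξ_f^{e_χω_ψ})`.»  Here `f` is the prime-to-`p` part of the conductor of `χ` (§4 p. 12: «`χ = ψω^i`», `ψ = χ|_Δ`) and
  `F ≤ ℚ(μ_m)` is the abelian field unramified at `p` of §3 (p. 5); Remark 3 (p. 9): «Under the assumption `p ∤ [K : ℚ]` … this is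
  well-known as the theorem of Iwasawa and Gillard».

## How it is typed (design; what is weaker than print)

* SCOPE, as in `CyclotomicColemanMap.lean`: `ℤ_p`-VALUED `χ` with the Dirichlet reading `χ = φω^i` (`φ` primitive mod `f ∣ m`), and
  — NEW here, Remark 3's regime — `p ∤ [F₀ : ℚ]` (hence `p ∤ #G = [F₀(μ_p) : ℚ]`).  In this regime `e_χ ∈ ℤ_p[G]`, the three
  readings of «the `χ`-part of `C`» (image under `e_χ`, `C ∩ 𝓤^χ`, `χ`-quotient) coincide, and the printed generator
  `ξ_f^{e_χ ω_ψ}` is `[ℚ(μ_f) ∩ F₀ : ℚ] · e_χ ξ_f` with `[ℚ(μ_f) ∩ F₀ : ℚ] ∈ ℤ_p^×` (each `δ` lifts to `δ̃ ∈ G` fixing `μ_p`, and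
  `e_χ δ̃ = χ(δ̃)e_χ = φ(δ)e_χ = ψ(δ)e_χ`), so «`C^χ` is generated by `ξ_f^{e_χω_ψ}`» reads «`e_χ(𝒞) = Λ · e_χ ξ_f`».
  `-- TODO(general form)`: `ℤ_p[χ]`-valued `χ`; `p ∣ [F₀ : ℚ]` (then the generator is the `ω_ψ`-twisted one).
* THE PROJECTOR is an explicit binder `e : 𝓤 →ₗ[Λ] 𝓤` with the three relations that determine `e_χ = |G|⁻¹Σ χ(g)⁻¹g` on
  `𝓤 = ⊕_ψ 𝓤^ψ`: values in `𝓤^χ`, identity on `𝓤^χ`, `e ∘ υ = χ(υ)·e` (the Summits-side predicate `IsChiProjector` spells the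
  same three lines; it is not importable here and is not restated as a definition).
* THE FAMILY `ξ_f` is VALUE-PINNED: global units `ξ n ∈ E(K_n)` with `ξ n = N_{ℚ(μ_{fp^{n+1}})/ℚ(μ_{fp^{n+1}}) ∩ K_n}(1 − ζ_n)` for a
  compatible system `ζ_n` of primitive `fp^{n+1}`-th roots of unity (`IsCompatibleRootSystem f p ζ`; the tree's `sinnottNorm` IS
  this partial norm, `CyclotomicColemanMap.lean` §1), and its image in `𝓤` is the PUSH `ξraw ∈ 𝓤` of the `q`-th powers for one
  `q` prime to `p` (`rep n (q • ξraw) = (1 ⊗ ξ n)^q`: the projection «kill the finite group of order prime to `p`» of p. 20, e.g.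
  `q = 48 = #𝔽₄₉^×` at `p = 7`; `q ∈ ℤ_p^×`, so `Λ·e ξraw` does not depend on `q`).
* CONCLUSION in the printed form «the image of `C` under `e_χ` is generated by `e_χ ξ_f`»: `D.cyc.map e = Λ ∙ e ξraw`.  The
  consumer's form `𝒞 ∩ 𝓤^χ = Λ·e ξraw` (`cycChi`) follows by pure algebra once `e ξraw ∈ 𝒞` (§3, PROVED).
* §1 records, PROVED, what the Coleman-map fact `tsuji1999_thm31_colemanMap` (case (i)) already yields: `𝒞^χ` is CYCLIC
  (`cycChi_eq_span_symm_of_colemanMap`), and `𝒞^χ = Λ·x` for any `x ∈ 𝒞^χ` whose Coleman image is a UNIT multiple of `g_χ`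
  (`cycChi_eq_span_of_colemanMap_of_isUnit`) — i.e. exactly the printed sentence «`Col(e_χ ξ_f) = −v(T)g_χ(T)·(unit)`» (Thm. 4.3 /
  Lemma 5.1 (a)) is what separates the fact below from Thm. 3.1 (i); the Coleman power series of `1 − ζ` is not in the tree.

## References
* T. Tsuji, J. Number Theory 78 (1999) 1–26: §3 (pp. 5–6, Remark 3 p. 9), §4 Thm. 4.3 (pp. 12–14), §5 Lemma 5.1 (a) (p. 14),
  §6 Lemma 6.1, Lemma 6.2 (a) and its proof (pp. 20–21). [Tsuji1999]
* C. Greither, Ann. Inst. Fourier 42 (1992) 449–499, Lemma 2.3 (generators of `𝒞`; cited through Tsuji's Lemma 6.1). [Greither1992 — cited via Tsuji1999]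
* B. Ferrero, L. Washington, Ann. of Math. 109 (1979) 377–395 (used in the printed proof). [FerreroWashington1979]
* S. Lang, *Cyclotomic Fields I and II* (1990), Ch. 7 §5 Thm. 5.1–5.2 (PDF pp. 132–133: the case `F₀ = ℚ`, Iwasawa). [Lang1990]
* K. Iwasawa, J. Math. Soc. Japan 16 (1964) 42–82; R. Gillard, Ann. Inst. Fourier 29 (1979) no. 4, 1–15. [Gillard1979UnitesII]
-/

noncomputable section

open scoped NumberField
open IsDedekindDomain Field PowerSeries
open Literature.NumberTheory.NumberFields Literature.NumberTheory.EllipticCurves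
open Literature.NumberTheory.ComplexMultiplication.EllipticUnits

namespace Literature.NumberTheory.IwasawaTheory

namespace CyclotomicSemilocalUnitData

variable {p : ℕ} [Fact p.Prime] {v : HeightOneSpectrum (𝓞 ℚ)} {L : ℕ → IntermediateField ℚ (AlgebraicClosure ℚ)}
  {hL : Monotone L} {Υ : Subgroup (absoluteGaloisGroup ℚ)} {γ₀ : absoluteGaloisGroup ℚ}
  (D : CyclotomicSemilocalUnitData p v L hL Υ γ₀) (χ : Υ →* ℤ_[p]ˣ)

/-! ### §1. What Thm. 3.1 (i) in Coleman-map form already gives: `𝒞^χ` is a cyclic `Λ`-module -/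

/-- **`𝒞^χ = Λ · Col⁻¹(g_χ)`**: under a `Λ`-isomorphism `Col : 𝓤^χ ≅ Λ` with `Col(𝒞^χ) = (g₀)` (the conclusion shape of
`tsuji1999_thm31_colemanMap`), `𝒞^χ` is cyclic, generated by `Col⁻¹ g₀`.  PROVED (pure algebra).
[cite: Tsuji1999, Thm. 3.1 (i) (p. 6) and Remark 3 (i) (p. 9)] -/
theorem cycChi_eq_span_symm_of_colemanMap (g₀ : IwasawaAlgebra p)
    (Col : D.chiPart χ ≃ₗ[IwasawaAlgebra p] IwasawaAlgebra p)
    (hCol : (D.cycChi χ).map Col.toLinearMap = Ideal.span {g₀}) :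
    D.cycChi χ = Submodule.span (IwasawaAlgebra p) {Col.symm g₀} := by
  have h : D.cycChi χ =
      Submodule.map (Col.symm : IwasawaAlgebra p ≃ₗ[IwasawaAlgebra p] D.chiPart χ).toLinearMap
        (Ideal.span {g₀} : Submodule (IwasawaAlgebra p) (IwasawaAlgebra p)) := by
    rw [← hCol, ← Submodule.map_comp]
    have : (Col.symm : IwasawaAlgebra p ≃ₗ[IwasawaAlgebra p] D.chiPart χ).toLinearMap ∘ₗ Col.toLinearMap =
        LinearMap.id :=
      LinearMap.ext fun x => Col.symm_apply_apply x
    rw [this, Submodule.map_id]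
  rw [h, Ideal.span, Submodule.map_span, Set.image_singleton]
  rfl

/-- **`𝒞^χ = Λ · x` as soon as `Col x` is a UNIT multiple of `g_χ`** (`x ∈ 𝓤^χ`): the algebra behind the printed step
«`Col(ξ_f^{e_χω_ψ}) = −v(T)g_χ(T)·ω_ψ(Tr ζ_f)e_χ`» ⟹ Lemma 6.2 (a).  PROVED. [cite: Tsuji1999, Lemma 6.2 (a), proof (p. 21 L14–24)] -/
theorem cycChi_eq_span_of_colemanMap_of_isUnit (g₀ : IwasawaAlgebra p)
    (Col : D.chiPart χ ≃ₗ[IwasawaAlgebra p] IwasawaAlgebra p)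
    (hCol : (D.cycChi χ).map Col.toLinearMap = Ideal.span {g₀}) (x : D.chiPart χ) {w : IwasawaAlgebra p}
    (hw : IsUnit w) (hx : Col x = w * g₀) :
    D.cycChi χ = Submodule.span (IwasawaAlgebra p) {x} := by
  rw [D.cycChi_eq_span_symm_of_colemanMap χ g₀ Col hCol]
  have hx' : x = w • Col.symm g₀ := by
    apply Col.injective
    rw [map_smul, LinearEquiv.apply_symm_apply, smul_eq_mul, hx]
  rw [hx', Submodule.span_singleton_smul_eq hw]

/-- Conversely, if `𝒞^χ = Λ·x` then `Col x` generates `(g₀)`: `Col x` and `g₀` are associated.  PROVED.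
[cite: Tsuji1999, Lemma 6.2 (a) (p. 21) with Thm. 3.1 (i) (p. 6)] -/
theorem span_colemanMap_eq_of_cycChi_eq_span (g₀ : IwasawaAlgebra p)
    (Col : D.chiPart χ ≃ₗ[IwasawaAlgebra p] IwasawaAlgebra p)
    (hCol : (D.cycChi χ).map Col.toLinearMap = Ideal.span {g₀}) (x : D.chiPart χ)
    (hx : D.cycChi χ = Submodule.span (IwasawaAlgebra p) {x}) :
    Ideal.span {Col x} = Ideal.span {g₀} := by
  rw [← hCol, hx, Submodule.map_span, Set.image_singleton]
  rfl

/-! ### §3. From the printed form «`e_χ(𝒞) = Λ·e_χ ξ`» to the left-exact form «`𝒞 ∩ 𝓤^χ = Λ·e_χ ξ`» -/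

/-- **`e_χ(𝒞) = Λ · e ξ` ⟹ `𝒞 ∩ 𝓤^χ = Λ · e ξ`** for a projector `e` with values in `𝓤^χ` which is the identity on `𝓤^χ`,
once `e ξ ∈ 𝒞` (every `m ∈ 𝒞 ∩ 𝓤^χ` is `e m ∈ e(𝒞)`).  PROVED (pure algebra; §2 (b) «the functor `M ↦ M^ψ` is left exact»).
[cite: Tsuji1999, §2 (b) (p. 4) and §6 (p. 20 L62–65, «C^χ the image of C under 𝓤 → 𝓤^χ»)] -/
theorem cycChi_eq_span_of_map_cyc_eq_span (e : D.M →ₗ[IwasawaAlgebra p] D.M)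
    (he₁ : ∀ m : D.M, e m ∈ D.chiPart χ) (he₂ : ∀ m : D.M, m ∈ D.chiPart χ → e m = m)
    {x : D.M} (hex : e x ∈ D.cyc)
    (h : D.cyc.map e = Submodule.span (IwasawaAlgebra p) {e x}) :
    D.cycChi χ = Submodule.span (IwasawaAlgebra p) {(⟨e x, he₁ x⟩ : D.chiPart χ)} := by
  apply le_antisymm
  · intro m hm
    rw [mem_cycChi_iff] at hm
    have hem : e (m : D.M) ∈ D.cyc.map e := Submodule.mem_map_of_mem hm
    rw [he₂ _ m.2, h, Submodule.mem_span_singleton] at hem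
    obtain ⟨a, ha⟩ := hem
    rw [Submodule.mem_span_singleton]
    exact ⟨a, Subtype.ext (by simpa using ha)⟩
  · rw [Submodule.span_le, Set.singleton_subset_iff]
    exact hex

end CyclotomicSemilocalUnitData

/-! ### §2. The named fact: Tsuji 1999, Lemma 6.2 (a) -/

section Fact

open CyclotomicUnits KubotaLeopoldt

/-- **Tsuji 1999, Lemma 6.2 (a) (with Lemma 6.1 = Greither 1992 Lemma 2.3, Thm. 4.3 and Lemma 5.1 (a), Ferrero–Washington): the
`χ`-part of the closed cyclotomic units is generated over `Λ_χ` by the projection of the conductor-level Sinnott family —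
`e_χ(𝒞) = Λ_χ · e_χ ξ_f`** — for `ℤ_p`-valued `χ` in the regime `p ∤ [F₀ : ℚ]` of Remark 3.  PRINT (p. 21): «Assume `χ = ψω^i` is a
non-trivial, even character of `G`. (a) The `Λ_χ`-module `C^χ` is generated by `ξ_f^{e_χ ω_ψ}`» with `C^χ` «the image of `C` under
`𝓤 → 𝓤^χ`» (p. 20) and `ξ_f = (N_{ℚ(μ_{fp^{n+1}})/ℚ(μ_{fp^{n+1}}) ∩ K_n}(1 − ζ_{p^{n+1}}ζ_f))_n` (p. 20).  TRANSCRIPTION (module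
docstring «How it is typed»): the binders of `tsuji1999_thm31_colemanMap` VERBATIM for the tower and the character (`p` odd;
`F₀ ≤ ℚ(μ_m)`, `p ∤ m`; `L = cyclotomicLayer F₀ p`; `v ∋ p`; `ζ` a primitive `mp`-th root of unity carrying the Dirichlet reading;
`u`, `γ₀`; `χ` trivial on `Gal(ℚ̄/K_∞)`, `χ = φω^i` with `φ` primitive mod `f ∣ m`, `ω` Teichmüller, `i ≤ p − 2`, `χ ≠ 1`, `χ`
even) WITHOUT the case distinction `χ₁(p) ≠ 1` (Lemma 6.2 has none) and without `g_χ`; NEW: `p ∤ [F₀ : ℚ]`; a compatible system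
`ζf` of primitive `fp^{n+1}`-th roots of unity; for every pinned datum `D` of `𝓤`, every `Λ`-linear `e` with the three projector
relations of `e_χ`, every family of global units `ξ n ∈ E(K_n)` with the Sinnott VALUE PIN at level `fp^{n+1}`, every `q` prime
to `p` and every push `ξraw ∈ 𝓤` of its `q`-th powers: **`D.cyc.map e = Λ ∙ e ξraw`**.  A named fact (D-0014); no `_holds`: the
printed proof runs through the Coleman power series of `1 − ζ` (Thm. 4.2–4.3, Lemma 5.1 (a)), the generators of `𝒞` (Lemma 6.1 =
Greither's Lemma 2.3) and Ferrero–Washington — none constructed in the tree (Thm. 3.1 (i) is itself the `∃ Col` fact, which gives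
only the cyclicity of `𝒞^χ`, §1); size L–XL.  WEAKER than print: `ℤ_p`-valued `χ`, `p ∤ [F₀ : ℚ]`.
[cite: Tsuji1999, §6 Lemma 6.2 (a) (p. 21 L5–8) with its proof (p. 21 L10–24), Lemma 6.1 (p. 20 L58–60), §6 (p. 20 L33–45, L62–65), Remark 3 (p. 9)]
[cite: Lang1990, Ch. 7 §5 Thm. 5.1–5.2 (PDF pp. 132–133; F₀ = ℚ)] [cite: Gillard1979UnitesII, Thm. 1–2] -/
def tsuji1999_lemma62a_cycChiGenerator : Prop :=
  ∀ (p : ℕ) [Fact p.Prime], p ≠ 2 →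
  ∀ (v : HeightOneSpectrum (𝓞 ℚ)), ((p : ℕ) : 𝓞 ℚ) ∈ v.asIdeal →
  ∀ (m : ℕ), 0 < m → m.Coprime p →
  ∀ (F₀ : IntermediateField ℚ (AlgebraicClosure ℚ)),
    F₀ ≤ IntermediateField.adjoin ℚ {x : AlgebraicClosure ℚ | x ^ m = 1} →
    ¬ p ∣ Module.finrank ℚ F₀ →
  ∀ (ζ : AlgebraicClosure ℚ), IsPrimitiveRoot ζ (m * p) →
  ∀ (u : ℤ_[p]ˣ), IsTopGenerator p (u : ℤ_[p]) →
  ∀ (γ₀ : absoluteGaloisGroup ℚ), GaloisRepresentations.GaloisRep.cyclotomicCharacter ℚ p γ₀ = u →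
    γ₀ ∈ fixingSubgroupQ (cyclotomicLayer F₀ p 0) →
  ∀ (χ : torsionCyclotomicSubgroup p →* ℤ_[p]ˣ),
    (∀ σ : torsionCyclotomicSubgroup p,
      (∀ n, (σ : absoluteGaloisGroup ℚ) ∈ fixingSubgroupQ (cyclotomicLayer F₀ p n)) → χ σ = 1) →
  ∀ (f : ℕ) [NeZero f], f ∣ m → ∀ (φ : DirichletCharacter ℤ_[p] f), φ.IsPrimitive →
  ∀ (ω : DirichletCharacter ℤ_[p] p), IsTeichmullerCharacter p ω →
  ∀ (i : ℕ), i ≤ p - 2 → ¬ (f = 1 ∧ i = 0) → φ (-1) = (-1) ^ i →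
    IsDirichletReading p (torsionCyclotomicSubgroup p) χ ζ φ ω i →
  ∀ (ζf : ℕ → AlgebraicClosure ℚ), IsCompatibleRootSystem f p ζf →
  ∀ (D : CyclotomicSemilocalUnitData p v (cyclotomicLayer F₀ p) (cyclotomicLayer_monotone F₀ p)
      (torsionCyclotomicSubgroup p) γ₀)
    (e : D.M →ₗ[IwasawaAlgebra p] D.M),
    (∀ x : D.M, e x ∈ D.chiPart χ) → (∀ x : D.M, x ∈ D.chiPart χ → e x = x) →
    (∀ (υ : torsionCyclotomicSubgroup p) (x : D.M),
      e (D.act υ x) = (C ((χ υ : ℤ_[p]ˣ) : ℤ_[p]) : IwasawaAlgebra p) • e x) →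
  ∀ (ξ : ∀ n : ℕ, globalUnitsOf (cyclotomicLayer F₀ p n)),
    (∀ n : ℕ, (((ξ n : globalUnitsOf (cyclotomicLayer F₀ p n)) : (AlgebraicClosure ℚ)ˣ) : AlgebraicClosure ℚ) =
      sinnottNorm (t := p ^ (n + 1) * f) (cyclotomicLayer F₀ p n) (ζf n) 1) →
  ∀ (q : ℕ), ¬ p ∣ q →
  ∀ (ξraw : D.M),
    (∀ n : ℕ, D.rep n (q • ξraw) = globalToSemilocalUnits v (cyclotomicLayer F₀ p n) (ξ n) ^ q) →
    D.cyc.map e = Submodule.span (IwasawaAlgebra p) {e ξraw}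

/-- **Corollary (the consumer's left-exact form): under the fact, `𝒞 ∩ 𝓤^χ = Λ · e ξ_f` once `e ξ_f ∈ 𝒞`.**  PROVED from the
fact and §3. [cite: Tsuji1999, §6 Lemma 6.2 (a) (p. 21) and §2 (b) (p. 4)] -/
theorem tsuji1999_lemma62a_cycChiGenerator.cycChi_eq_span (hfact : tsuji1999_lemma62a_cycChiGenerator)
    {p : ℕ} [Fact p.Prime] (hp : p ≠ 2) {v : HeightOneSpectrum (𝓞 ℚ)} (hv : ((p : ℕ) : 𝓞 ℚ) ∈ v.asIdeal)
    {m : ℕ} (hm : 0 < m) (hmp : m.Coprime p) {F₀ : IntermediateField ℚ (AlgebraicClosure ℚ)}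
    (hF₀ : F₀ ≤ IntermediateField.adjoin ℚ {x : AlgebraicClosure ℚ | x ^ m = 1}) (hdeg : ¬ p ∣ Module.finrank ℚ F₀)
    {ζ : AlgebraicClosure ℚ} (hζ : IsPrimitiveRoot ζ (m * p)) {u : ℤ_[p]ˣ} (hu : IsTopGenerator p (u : ℤ_[p]))
    {γ₀ : absoluteGaloisGroup ℚ} (hγ₀ : GaloisRepresentations.GaloisRep.cyclotomicCharacter ℚ p γ₀ = u)
    (hγ₀K : γ₀ ∈ fixingSubgroupQ (cyclotomicLayer F₀ p 0)) {χ : torsionCyclotomicSubgroup p →* ℤ_[p]ˣ}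
    (hχ : ∀ σ : torsionCyclotomicSubgroup p,
      (∀ n, (σ : absoluteGaloisGroup ℚ) ∈ fixingSubgroupQ (cyclotomicLayer F₀ p n)) → χ σ = 1)
    {f : ℕ} [NeZero f] (hf : f ∣ m) {φ : DirichletCharacter ℤ_[p] f} (hφ : φ.IsPrimitive)
    {ω : DirichletCharacter ℤ_[p] p} (hω : IsTeichmullerCharacter p ω) {i : ℕ} (hi : i ≤ p - 2)
    (hχ1 : ¬ (f = 1 ∧ i = 0)) (heven : φ (-1) = (-1) ^ i)
    (hread : IsDirichletReading p (torsionCyclotomicSubgroup p) χ ζ φ ω i)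
    {ζf : ℕ → AlgebraicClosure ℚ} (hζf : IsCompatibleRootSystem f p ζf)
    (D : CyclotomicSemilocalUnitData p v (cyclotomicLayer F₀ p) (cyclotomicLayer_monotone F₀ p)
      (torsionCyclotomicSubgroup p) γ₀)
    {e : D.M →ₗ[IwasawaAlgebra p] D.M} (he₁ : ∀ x : D.M, e x ∈ D.chiPart χ)
    (he₂ : ∀ x : D.M, x ∈ D.chiPart χ → e x = x)
    (he₃ : ∀ (υ : torsionCyclotomicSubgroup p) (x : D.M),
      e (D.act υ x) = (C ((χ υ : ℤ_[p]ˣ) : ℤ_[p]) : IwasawaAlgebra p) • e x)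
    {ξ : ∀ n : ℕ, globalUnitsOf (cyclotomicLayer F₀ p n)}
    (hξ : ∀ n : ℕ, (((ξ n : globalUnitsOf (cyclotomicLayer F₀ p n)) : (AlgebraicClosure ℚ)ˣ) : AlgebraicClosure ℚ) =
      sinnottNorm (t := p ^ (n + 1) * f) (cyclotomicLayer F₀ p n) (ζf n) 1)
    {q : ℕ} (hq : ¬ p ∣ q) {ξraw : D.M}
    (hξraw : ∀ n : ℕ, D.rep n (q • ξraw) = globalToSemilocalUnits v (cyclotomicLayer F₀ p n) (ξ n) ^ q)
    (hmem : e ξraw ∈ D.cyc) :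
    D.cycChi χ = Submodule.span (IwasawaAlgebra p) {(⟨e ξraw, he₁ ξraw⟩ : D.chiPart χ)} :=
  D.cycChi_eq_span_of_map_cyc_eq_span χ e he₁ he₂ hmem
    (hfact p hp v hv m hm hmp F₀ hF₀ hdeg ζ hζ u hu γ₀ hγ₀ hγ₀K χ hχ f hf φ hφ ω hω i hi hχ1 heven hread ζf hζf D e he₁ he₂
      he₃ ξ hξ q hq ξraw hξraw)

end Fact

end Literature.NumberTheory.IwasawaTheory

end
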